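import Literature.MathematicalPhysics.QuantumFieldTheory.Balaban1983to89.B9C2LettersTorusY
import Literature.MathematicalPhysics.QuantumFieldTheory.Balaban1983to89.B7Eq52RetractionExtension
import Literature.MathematicalPhysics.QuantumFieldTheory.Balaban1983to89.B9Eq335CoveragePAtLettersY
import Literature.MathematicalPhysics.QuantumFieldTheory.Balaban1983to89.B9Letters313AtOneQ

/-!
# `Balaban1983to89.B9C2FormBoxRegimeY` — [B9] (3.35) p. 396 ∕ (3.69) p. 404 with [B7] (52) p. 26 and [4] (2.3) p. 224: **THE [B7] BOX OF AN INDEX BOND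
`c ∈ 𝔅` AT NODE 00's CARRIERS — it is the DOUBLE BLOCK `Bʲ(c₋) ∪ Bʲ(c₊)` of [4]; its sites have level `j(c)` or `j(c) − 1`; under print's class (3.35) every
plaquette variable based in it is within `K_pl·L⁴·(L^{j(c)})⁻²` of `1`; hence the RETRACTED READING of the member configuration satisfies [B7]'s GLOBAL (52) at
level `j(c)` with that constant** — the regime input of `B9C2LettersTorusY` §3

T. Bałaban, *Propagators for lattice gauge theories in a background field*, Commun. Math. Phys. **99** (1985) 389–434 [`Balaban1985BackgroundPropagators`, "B9"];
[B7] = T. Bałaban, *Averaging operations for lattice gauge theories*, Commun. Math. Phys. **98** (1985) 17–51 [`Balaban1985Averaging`]; [4] = T. Bałaban, *Propagators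
and renormalization transformations for lattice gauge theories. II*, Commun. Math. Phys. **96** (1984) 223–250 [`Balaban1984PropagatorsII`].
statement-level skeleton of published theorems with citation tags; proofs where landed; nothing here is a claim about the Yang–Mills mass gap.

THE PRINT.  [B9] (3.35) p. 396 (the cube class and its gauge: `|A| < O(1)Mα₀(Lʲη)⁻¹`, `|∇A| < O(1)Mα₀(Lʲη)⁻²`); p. 404 (3.69) («the estimates follow directly from the
assumptions (3.35)»: the plaquette variables near `Λ_j` are within `O(1)Mα₀(Lʲη)⁻²·η²` of `1`); [B7] (52) p. 26 with Prop. 2's locality sentence; [4] (2.3) p. 224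
(`Λ_j`, the end blocks of its bonds).

WHY THIS FILE (seat dag-n06-l g34, programme P-C2 piece P5 at the carriers; memo `HOME/pub-ymgap-dag-n06-l/C2-INSTANCE-MEMO.md`).  `B9C2LettersTorusY` §3 delivers the
(149) entries of the raw datum `rawFormY` at an index bond `c` in [B7]'s regime for ANY background `Û` agreeing with the periodic reading `readY U` on [B7]'s box
`[Lʲz(c), Lʲz(c) + Lʲ − 1 (+ Lʲe_κ)]`.  THIS FILE identifies that box with the tree's double block of `c` (`B6Ineq2142KLevelV1`: «ends» `iterBlockOf j x ∈ {c₋, c₊}`),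
imports the tree's level window `lev_ends_bounds` (levels `j` or `j − 1`) and block distance `geomT_dist_ends_le` (`d(β c, block of x) ≤ ℓ + 3`), reads n06-j's per-plaquette
form of (3.35) (`B9Eq335CoveragePAtLettersY.norm_holY_sub_one_le_levelled_of_reg335P`, `K_pl·(L^{lev − 1})⁻²`) on [B7]'s plaquette words of the reading, and feeds
`B7Eq52RetractionExtension.pdev_retrCfg_le`: the retracted reading `Û_c := retrCfg (box of c) (readY U)` has `pdev Û_c ≤ K_pl·L⁴·(L^{j(c)})⁻²`, agrees with `readY U`
on the box, and is `G`-valued.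

WHAT THIS FILE PROVES (0 sorry; theorems only).
* §1 the box is the double block: `val_proj_of_lt`, ★ `ends_of_inBox` (`y` in [B7]'s box of `c` ⇒ `iterBlockOf j(c) (proj y) ∈ {c.src, c.tgt}`), `lo_le_hi_box`.
* §2 the plaquette words of the reading: `proj_add_e` (`proj (y + e_μ) = (proj y).shift μ`), ★ `hol_readY_plaqWord_of_lt ∕ _of_gt` (= `holY` ∕ its inverse), `hol_readY_plaqWord_self`.
* §3 ★★ `norm_hol_readY_plaqWord_sub_one_le_of_reg335P` — under `(bg9KP …).Reg335 c₀ α₀ U` (`c₀ ≤ 10`): every plaquette word of `readY U` with corners in the box of `c` is within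
  `K_pl·L⁴·(L^{j(c)})⁻²` of `1`; ★★★ `pdev_retract_readY_le_of_reg335P` (the retracted reading satisfies the GLOBAL (52) bound), `retract_readY_agree`, `retract_readY_mem`.
* §4 the geometry line for the socket: ★ `dist_bI_le_of_ends` (`d_{geo9K}(c, bI f) ≤ ℓ + 4` for a fine bond `f` whose source lies in the double block, `bI` 1-faithful),
  ★ `dist_bI_le_of_boxCount_ne_zero` (the same from `N_c(f) ≠ 0`).
-/

noncomputable section

open scoped BigOperators Matrix.Norms.L2Operator

namespace Literature.MathematicalPhysics.QuantumFieldTheory.Balaban1983to89.B9C2FormBoxRegimeY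

open Node00 (CfgY FBondY IBondY SiteY)
open B6KLevelCensusIndexV1 (KIdx kGeo)
open B6GlobalChartV1 (PV domT toBox blkV1)
open B6Ineq2142KLevelV1 (lvl lvl_le_mK β lev_ends_bounds geomT_dist_ends_le one_le_lvl)
open B7Prop1Local (InBox AgreeOn loK bondHiK)
open B7Prop1Explicit (hol plaqWord e U1)
open B7Prop2Explicit (hol_plaqWord_self)
open B7Prop2Explicit (pdev unitaryUnits)
open B7Prop5Flat (BondIn mem_bondsIn)
open B7AvgPeriodicity (proj torusLift proj_torusLift)
open B12Ineq417Flat (boxBonds)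
open B7Eq52RetractionExtension (retrCfg retrCfg_eq_of_bondIn retrCfg_mem pdev_retrCfg_le)
open B7Eq136SecondOrderPeriodic (boxCount)
open B9C2LettersTorusY (T0 readY readY_apply zOf κOf)
open B9BackgroundsKLevelV1 (levV1)
open B9BackgroundsKLevelV1P (bg9KP mem_of_reg335P)
open B5Eq118OneStroke (iterBlockOf val_iterBlockOf)
open B9Eq335CoveragePAtLettersY (norm_holY_sub_one_le_levelled_of_reg335P)
open B9GeoNormsKLevelV1 (geo9K)
open B6Geom246MultiLevelTorus (geomT)
open B9GeoLemma21KLevelV1 (one_le_Mh one_le_P one_le_k)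
open B9Eq3132Ineq2142Covariant (two_le_RMh)
open B9Ineq349SiteComposite (distB)
open B9Ineq349SiteFromBlocks (distB_triangle)
open B6Ineq288MultiLevelTorus (dist_symm_geoBT)
open Node00 (toKT)

variable {d ℓ : ℕ} {hd : 1 ≤ d + 1} {hL : Odd (ℓ + 1) ∧ 1 < ℓ + 1} {b₀ b₁ : ℝ}
variable (i : KIdx d ℓ hd hL b₀ b₁)

/-! ## §1 [B7]'s box of an index bond is the double block `Bʲ(c₋) ∪ Bʲ(c₊)` -/

section Box

/-- the coarse coordinates of an index bond are the labels of its source: `0 ≤ z(c)_μ < T₀ ∕ Lʲ` and `Lʲ·(T₀∕Lʲ) = T₀`. [cite: Balaban1987RG1, (0.1) p.252, bookkeeping] -/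
theorem zOf_apply (c : IBondY i) (μ : Fin (d + 1)) : zOf i c μ = ((c.1.2.src μ).val : ℤ) := rfl

/-- the level periods: `Lʲ·T_j = T₀` for `j ≤ m + K`. [cite: Balaban1987RG1, (0.1) p.251, bookkeeping] -/
theorem pow_mul_sitesPerDir (j : ℕ) (hj : j ≤ i.m + i.K) :
    (ℓ + 1) ^ j * (PV d ℓ i.m i.K hd hL).sitesPerDir j = T0 i := by
  show (ℓ + 1) ^ j * (2 * (ℓ + 1) ^ (i.m + i.K - j)) = 2 * (ℓ + 1) ^ (i.m + i.K - 0)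
  rw [Nat.sub_zero, mul_left_comm, ← pow_add, Nat.add_sub_cancel' hj]

/-- the value of `(proj y)_μ` for `0 ≤ y_μ < T₀` is `y_μ`. [cite: Balaban1987RG1, (0.1) p.251, bookkeeping] -/
theorem val_proj_of_lt {y : B7Prop1Explicit.Site (d + 1)} {μ : Fin (d + 1)} (h0 : 0 ≤ y μ) (hT : y μ < (T0 i : ℤ)) :
    ((proj (T0 i) y μ).val : ℤ) = y μ := by
  simp only [proj, ZMod.val_intCast]
  exact Int.emod_eq_of_lt h0 hT

/-- the value of `(proj y)_μ` for `T₀ ≤ y_μ < 2T₀` is `y_μ − T₀`. [cite: Balaban1987RG1, (0.1) p.251, bookkeeping] -/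
theorem val_proj_of_ge {y : B7Prop1Explicit.Site (d + 1)} {μ : Fin (d + 1)} (h0 : (T0 i : ℤ) ≤ y μ) (hT : y μ < 2 * (T0 i : ℤ)) :
    ((proj (T0 i) y μ).val : ℤ) = y μ - T0 i := by
  simp only [proj, ZMod.val_intCast]
  have heq : y μ = (y μ - T0 i) + 1 * (T0 i : ℤ) := by ring
  have h1 : 0 ≤ y μ - T0 i := by linarith
  have h2 : y μ - T0 i < T0 i := by linarith
  rw [show y μ % (T0 i : ℤ) = ((y μ - T0 i) + 1 * (T0 i : ℤ)) % (T0 i : ℤ) by rw [← heq], Int.add_mul_emod_self_right,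
    Int.emod_eq_of_lt h1 h2]

/-- ★ **A SITE OF [B7]'s BOX OF `c` LIES IN THE DOUBLE BLOCK**: `iterBlockOf j(c) (proj y) = c₋` or `= c₊`.
[cite: Balaban1984PropagatorsII, (2.3) p.224 («Λ_j»); Balaban1985Averaging, p.24 («Bᵏ(c₋) ∪ Bᵏ(c₊)»)] -/
theorem ends_of_inBox (c : IBondY i) {y : B7Prop1Explicit.Site (d + 1)}
    (hy : InBox (loK (ℓ + 1) (lvl i.hN i.D i.hk c) (zOf i c)) (bondHiK (ℓ + 1) (lvl i.hN i.D i.hk c) (zOf i c) (κOf i c)) y) :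
    iterBlockOf (lvl i.hN i.D i.hk c) (proj (T0 i) y) = c.1.2.src ∨ iterBlockOf (lvl i.hN i.D i.hk c) (proj (T0 i) y) = c.1.2.tgt := by
  set j := lvl i.hN i.D i.hk c with hj
  have hjm : j ≤ i.m + i.K := lvl_le_mK i.hN i.D i.hk c
  have hjm' : j ≤ (PV d ℓ i.m i.K hd hL).m + (PV d ℓ i.m i.K hd hL).K := hjm
  set Lj : ℤ := ((ℓ : ℤ) + 1) ^ j with hLj
  have hLj0 : 0 < Lj := by positivity
  have hLjnat : (((ℓ + 1) ^ j : ℕ) : ℤ) = Lj := by push_cast; ring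
  set Tj : ℕ := (PV d ℓ i.m i.K hd hL).sitesPerDir j with hTj
  have hTj1 : 1 ≤ Tj := NeZero.pos Tj
  have hperZ : Lj * (Tj : ℤ) = (T0 i : ℤ) := by
    have h := pow_mul_sitesPerDir i j hjm
    have h' : (((ℓ + 1) ^ j * Tj : ℕ) : ℤ) = (T0 i : ℤ) := by exact_mod_cast h
    rw [← h', Nat.cast_mul, hLjnat]
  have hsrc : ∀ μ, zOf i c μ = ((c.1.2.src μ).val : ℤ) := fun μ => rfl
  have hsrclt : ∀ μ, (c.1.2.src μ).val + 1 ≤ Tj := fun μ => ZMod.val_lt _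
  -- label division: `Lʲk ≤ m < Lʲ(k+1) ⇒ m ∕ Lʲ = k`
  have hdiv : ∀ {mv kv : ℕ}, Lj * kv ≤ (mv : ℤ) → (mv : ℤ) < Lj * (kv + 1) → mv / (ℓ + 1) ^ j = kv := by
    intro mv kv h1 h2
    apply Nat.div_eq_of_lt_le
    · have h : ((kv * (ℓ + 1) ^ j : ℕ) : ℤ) ≤ mv := by push_cast; rw [hLj] at h1; nlinarith [h1]
      exact_mod_cast h
    · have h : (mv : ℤ) < (((kv + 1) * (ℓ + 1) ^ j : ℕ) : ℤ) := by push_cast; rw [hLj] at h2; nlinarith [h2]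
      exact_mod_cast h
  -- the coordinates of `y`: `Lʲ z_μ ≤ y_μ ≤ Lʲ z_μ + Lʲ − 1 (+ Lʲ at μ = κ)`
  have hlo : ∀ μ, Lj * (c.1.2.src μ).val ≤ y μ := fun μ => by
    have := (hy μ).1; simp only [loK, hsrc] at this; rw [hLj]; exact_mod_cast this
  have hhi : ∀ μ, y μ ≤ Lj * (c.1.2.src μ).val + (Lj - 1) + (if μ = κOf i c then Lj else 0) := fun μ => by
    have := (hy μ).2; simp only [bondHiK, hsrc] at this; rw [hLj]; exact_mod_cast this
  -- a coordinate in the source block: value and label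
  have srcCoord : ∀ μ, y μ ≤ Lj * (c.1.2.src μ).val + (Lj - 1) → ((proj (T0 i) y) μ).val / (ℓ + 1) ^ j = (c.1.2.src μ).val := by
    intro μ hup
    have hy0 : 0 ≤ y μ := le_trans (by positivity) (hlo μ)
    have hyT : y μ < (T0 i : ℤ) := by
      have h1 : ((c.1.2.src μ).val : ℤ) + 1 ≤ Tj := by exact_mod_cast hsrclt μ
      rw [← hperZ]; nlinarith
    have hv : (((proj (T0 i) y) μ).val : ℤ) = y μ := val_proj_of_lt i hy0 hyT
    exact hdiv (by rw [hv]; exact hlo μ) (by rw [hv]; linarith)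
  by_cases hfirst : y (κOf i c) ≤ Lj * (c.1.2.src (κOf i c)).val + (Lj - 1)
  · -- every coordinate in the block of the source
    left
    funext μ
    apply ZMod.val_injective
    rw [val_iterBlockOf j hjm' (proj (T0 i) y) μ]
    refine srcCoord μ ?_
    by_cases hμ : μ = κOf i c
    · rw [hμ]; exact hfirst
    · have := hhi μ; rw [if_neg hμ, add_zero] at this; exact this
  · -- the `κ`-coordinate in the block of the target, the others in the block of the source
    right
    push Not at hfirst
    funext μ
    apply ZMod.val_injective
    rw [val_iterBlockOf j hjm' (proj (T0 i) y) μ]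
    by_cases hμ : μ = κOf i c
    · subst hμ
      have htgt : (c.1.2.tgt (κOf i c)).val = ((c.1.2.src (κOf i c)).val + 1) % Tj := by
        show ((c.1.2.src.shift c.1.2.dir) (κOf i c)).val = _
        simp only [Site.shift, κOf, Function.update_self]
        rw [ZMod.val_add, ZMod.val_one_eq_one_mod, Nat.add_mod_mod]
      rw [htgt]
      have hupκ : y (κOf i c) ≤ Lj * ((c.1.2.src (κOf i c)).val + 1) + (Lj - 1) := by
        have := hhi (κOf i c); rw [if_pos rfl] at this; linarith
      have hloκ : Lj * ((c.1.2.src (κOf i c)).val + 1) ≤ y (κOf i c) := by linarith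
      by_cases hwrap : (c.1.2.src (κOf i c)).val + 1 < Tj
      · rw [Nat.mod_eq_of_lt hwrap]
        have hy0 : 0 ≤ y (κOf i c) := le_trans (by positivity) hloκ
        have hyT : y (κOf i c) < (T0 i : ℤ) := by
          have h1 : ((c.1.2.src (κOf i c)).val : ℤ) + 2 ≤ Tj := by exact_mod_cast hwrap
          rw [← hperZ]; nlinarith
        have hv : (((proj (T0 i) y) (κOf i c)).val : ℤ) = y (κOf i c) := val_proj_of_lt i hy0 hyT
        exact hdiv (by rw [hv]; push_cast; exact hloκ) (by rw [hv]; push_cast; linarith)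
      · -- wrap-around: `c₋_κ = T_j − 1`, `c₊_κ = 0`, `y_κ ∈ [T₀, T₀ + Lʲ − 1]`
        have heq : (c.1.2.src (κOf i c)).val + 1 = Tj := by have := hsrclt (κOf i c); omega
        rw [heq, Nat.mod_self]
        have heqZ : ((c.1.2.src (κOf i c)).val : ℤ) + 1 = Tj := by exact_mod_cast heq
        have hyT0 : (T0 i : ℤ) ≤ y (κOf i c) := by rw [← hperZ, ← heqZ]; exact hloκ
        have hy2T : y (κOf i c) < 2 * (T0 i : ℤ) := by
          rw [← hperZ, ← heqZ]
          have : Lj ≤ Lj * (((c.1.2.src (κOf i c)).val : ℤ) + 1) :=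
            le_mul_of_one_le_right hLj0.le (by have := Nat.cast_nonneg (α := ℤ) (c.1.2.src (κOf i c)).val; linarith)
          linarith
        have hv : (((proj (T0 i) y) (κOf i c)).val : ℤ) = y (κOf i c) - T0 i := val_proj_of_ge i hyT0 hy2T
        exact hdiv (by rw [hv]; push_cast; linarith) (by rw [hv, ← hperZ, ← heqZ]; push_cast; linarith)
    · have htgt : c.1.2.tgt μ = c.1.2.src μ := by
        show (c.1.2.src.shift c.1.2.dir) μ = _
        simp only [Site.shift]
        rw [Function.update_of_ne]
        exact hμ
      rw [htgt]
      have := hhi μ; rw [if_neg hμ, add_zero] at this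
      exact srcCoord μ this

/-- the box has `lo ≤ hi` coordinatewise. [cite: Balaban1985Averaging, p.24, bookkeeping] -/
theorem lo_le_hi_box (c : IBondY i) (μ : Fin (d + 1)) :
    loK (ℓ + 1) (lvl i.hN i.D i.hk c) (zOf i c) μ ≤ bondHiK (ℓ + 1) (lvl i.hN i.D i.hk c) (zOf i c) (κOf i c) μ := by
  simp only [loK, bondHiK]
  have : (1 : ℤ) ≤ ((ℓ : ℤ) + 1) ^ lvl i.hN i.D i.hk c := one_le_pow₀ (by linarith)
  split_ifs <;> push_cast <;> nlinarith

end Box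

/-! ## §2 The plaquette words of the periodic reading are def-Y's plaquette holonomies -/

section Plaquettes

variable {𝔸 : Type} [NormedRing 𝔸] [NormedAlgebra ℂ 𝔸] [CompleteSpace 𝔸]

/-- `proj (y + e_μ) = (proj y) + e_μ` on the torus. [cite: Balaban1987RG1, (0.1) p.251, bookkeeping] -/
theorem proj_add_e (y : B7Prop1Explicit.Site (d + 1)) (μ : Fin (d + 1)) :
    proj (T0 i) (y + e μ) = Site.shift (P := PV d ℓ i.m i.K hd hL) (proj (T0 i) y) μ := by
  funext ν
  simp only [proj, Site.shift, e, Pi.add_apply, Function.update_apply]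
  by_cases h : ν = μ
  · subst h; simp
  · simp [h]

/-- ★ **[B7]'s plaquette word of the reading IS the plaquette holonomy (3.1)** for `μ < ν`:
`(readY U)(∂p_{y; μ, ν}) = U(∂p)` at `p = ⟨y mod T₀, μ, ν⟩`. [cite: Balaban1985BackgroundPropagators, (3.1) p.390] [cite: Balaban1985Averaging, (5) p.18, (44) p.24] -/
theorem hol_readY_plaqWord (U : CfgY 𝔸 i) (y : B7Prop1Explicit.Site (d + 1)) {μ ν : Fin (d + 1)} (hμν : μ < ν) :
    hol (readY i U) y (plaqWord μ ν) = Node00.holY i U ⟨proj (T0 i) y, μ, ν, hμν⟩ := by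
  have h1 : y + e μ + e ν + -e μ = y + e ν := by abel
  have h2 : y + e ν + -e ν = y := by abel
  have h3 : y + e μ + e ν - e μ = y + e ν := by abel
  have h4 : y + e ν - e ν = y := by abel
  simp only [plaqWord, hol, B7Prop1Explicit.stepHol_true, B7Prop1Explicit.stepHol_false, B7Prop1Explicit.Letter.vec, if_true,
    Bool.false_eq_true, if_false, mul_one, readY_apply, Node00.holY, h1, h3, h4, mul_assoc]
  rw [proj_add_e, proj_add_e]

/-- the reversed orientation gives the inverse holonomy. [cite: Balaban1985BackgroundPropagators, (3.5) p.391 («U(−∂p) = U(∂p)⁻¹»)] -/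
theorem hol_readY_plaqWord_swap (U : CfgY 𝔸 i) (y : B7Prop1Explicit.Site (d + 1)) {μ ν : Fin (d + 1)} (hμν : μ < ν) :
    hol (readY i U) y (plaqWord ν μ) = (Node00.holY i U ⟨proj (T0 i) y, μ, ν, hμν⟩)⁻¹ := by
  have h1 : y + e ν + e μ + -e ν = y + e μ := by abel
  have h2 : y + e μ + -e μ = y := by abel
  have h3 : y + e ν + e μ - e ν = y + e μ := by abel
  have h4 : y + e μ - e μ = y := by abel
  simp only [plaqWord, hol, B7Prop1Explicit.stepHol_true, B7Prop1Explicit.stepHol_false, B7Prop1Explicit.Letter.vec, if_true,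
    Bool.false_eq_true, if_false, mul_one, readY_apply, Node00.holY, h1, h3, h4, mul_inv_rev, inv_inv, mul_assoc]
  rw [proj_add_e, proj_add_e]

end Plaquettes

/-! ## §3 Under print's class (3.35): the plaquettes of the box, and the retracted reading's (52) -/

section Regime

variable {N : ℕ} [Nonempty (Fin N)] {G : Subgroup (Matrix (Fin N) (Fin N) ℂ)ˣ}

/-- the [B7]∕[B9] plaquette constant of n06-j's levelled reading: `K_pl(t) = 2·(10Lt)(1 + 10Lt)e^{4·10Lt}`, `t = M·α₀`. [cite: Balaban1985BackgroundPropagators, (3.69) p.404, bookkeeping] -/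
def Kpl (i : KIdx d ℓ hd hL b₀ b₁) (t : ℝ) : ℝ :=
  2 * (10 * (kGeo i).L * t) * (1 + 10 * (kGeo i).L * t) * Real.exp (4 * (10 * (kGeo i).L * t))

/-- `K_pl ≥ 0` for `t ≥ 0`. [cite: Balaban1985BackgroundPropagators, (3.69) p.404, bookkeeping] -/
theorem Kpl_nonneg {t : ℝ} (ht : 0 ≤ t) : 0 ≤ Kpl i t := by
  unfold Kpl
  have : (0 : ℝ) ≤ (kGeo i).L := by rw [show (kGeo i).L = ((ℓ + 1 : ℕ) : ℝ) from rfl]; positivity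
  positivity

/-- the scale slack: a site of the double block has level `≥ j(c) − 1`, so `(L^{lev − 1})⁻² ≤ L⁴·(L^{j(c)})⁻²`. [cite: Balaban1984PropagatorsII, (2.2)–(2.4) p.224, bookkeeping] -/
theorem scale_slack {n j : ℕ} (h : j - 1 ≤ n) :
    (((kGeo i).L ^ (n - 1))⁻¹) ^ 2 ≤ (kGeo i).L ^ 4 * ((((kGeo i).L ^ j)⁻¹) ^ 2) := by
  have hL1 : (1 : ℝ) ≤ (kGeo i).L := by
    rw [show (kGeo i).L = ((ℓ + 1 : ℕ) : ℝ) from rfl]; exact_mod_cast Nat.succ_le_succ (Nat.zero_le ℓ)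
  have hL0 : (0 : ℝ) < (kGeo i).L := lt_of_lt_of_le one_pos hL1
  have hjn : j ≤ (n - 1) + 2 := by omega
  have hpow : (kGeo i).L ^ j ≤ (kGeo i).L ^ ((n - 1) + 2) := pow_le_pow_right₀ hL1 hjn
  have hpos1 : 0 < (kGeo i).L ^ (n - 1) := pow_pos hL0 _
  have hposj : 0 < (kGeo i).L ^ j := pow_pos hL0 _
  have h1 : ((kGeo i).L ^ (n - 1))⁻¹ ≤ (kGeo i).L ^ 2 * ((kGeo i).L ^ j)⁻¹ := by
    have hq : 0 < (kGeo i).L ^ j / (kGeo i).L ^ 2 := by positivity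
    rw [show (kGeo i).L ^ 2 * ((kGeo i).L ^ j)⁻¹ = ((kGeo i).L ^ j / (kGeo i).L ^ 2)⁻¹ by rw [inv_div, div_eq_mul_inv]]
    apply inv_anti₀ hq
    rw [div_le_iff₀ (by positivity), ← pow_add]
    exact hpow
  have h0 : 0 ≤ ((kGeo i).L ^ (n - 1))⁻¹ := by positivity
  calc (((kGeo i).L ^ (n - 1))⁻¹) ^ 2 ≤ ((kGeo i).L ^ 2 * ((kGeo i).L ^ j)⁻¹) ^ 2 := pow_le_pow_left₀ h0 h1 2
    _ = (kGeo i).L ^ 4 * ((((kGeo i).L ^ j)⁻¹) ^ 2) := by ring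

/-- ★★ **EVERY PLAQUETTE WORD OF THE READING WITH CORNERS IN THE BOX OF `c` IS WITHIN `K_pl·L⁴·(L^{j(c)})⁻²` OF `1`** under print's class (3.35) (`bg9KP`, `c₀ ≤ 10`,
unit-bounded `G`): the corner lies in the double block (§1), hence has level `≥ j(c) − 1` (`lev_ends_bounds`), and n06-j's levelled plaquette reading of (3.35) applies (its inverse
for the reversed orientation, `1` for a degenerate word). [cite: Balaban1985BackgroundPropagators, (3.35) p.396, (3.69) p.404] [cite: Balaban1985Averaging, (52) p.26] -/
theorem norm_hol_readY_plaqWord_sub_one_le_of_reg335P (hG1 : ∀ u : (Matrix (Fin N) (Fin N) ℂ)ˣ, u ∈ G → ‖(u : Matrix (Fin N) (Fin N) ℂ)‖ ≤ 1)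
    (U : CfgY (Matrix (Fin N) (Fin N) ℂ) i) {c₀ α₀ : ℝ} (hc : c₀ ≤ 10) (hMα : 0 ≤ (kGeo i).M * α₀)
    (hreg : (bg9KP (Matrix (Fin N) (Fin N) ℂ) G i).Reg335 c₀ α₀ U) (c : IBondY i) {y : B7Prop1Explicit.Site (d + 1)}
    (hy : InBox (loK (ℓ + 1) (lvl i.hN i.D i.hk c) (zOf i c)) (bondHiK (ℓ + 1) (lvl i.hN i.D i.hk c) (zOf i c) (κOf i c)) y) (μ ν : Fin (d + 1)) :
    ‖((hol (readY i U) y (plaqWord μ ν) : (Matrix (Fin N) (Fin N) ℂ)ˣ) : Matrix (Fin N) (Fin N) ℂ) - 1‖ ≤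
      Kpl i ((kGeo i).M * α₀) * ((kGeo i).L ^ 4 * ((((kGeo i).L ^ lvl i.hN i.D i.hk c)⁻¹) ^ 2)) := by
  have hK0 : 0 ≤ Kpl i ((kGeo i).M * α₀) := Kpl_nonneg i hMα
  have hL0 : (0 : ℝ) ≤ (kGeo i).L := by rw [show (kGeo i).L = ((ℓ + 1 : ℕ) : ℝ) from rfl]; positivity
  have hR0 : 0 ≤ Kpl i ((kGeo i).M * α₀) * ((kGeo i).L ^ 4 * ((((kGeo i).L ^ lvl i.hN i.D i.hk c)⁻¹) ^ 2)) := by positivity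
  -- the corner has level `≥ j(c) − 1`
  have hlev : lvl i.hN i.D i.hk c - 1 ≤ levV1 i (proj (T0 i) y) :=
    (lev_ends_bounds i.hN i.D i.hk (one_le_k i) (two_le_RMh i) c (ends_of_inBox i c hy)).1
  have hslack := scale_slack i (n := levV1 i (proj (T0 i) y)) (j := lvl i.hN i.D i.hk c) hlev
  -- the levelled reading at an oriented plaquette based at the corner
  have key : ∀ {μ' ν' : Fin (d + 1)} (h : μ' < ν'),
      ‖((Node00.holY i U ⟨proj (T0 i) y, μ', ν', h⟩ : (Matrix (Fin N) (Fin N) ℂ)ˣ) : Matrix (Fin N) (Fin N) ℂ) - 1‖ ≤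
        Kpl i ((kGeo i).M * α₀) * ((kGeo i).L ^ 4 * ((((kGeo i).L ^ lvl i.hN i.D i.hk c)⁻¹) ^ 2)) := fun h =>
    (norm_holY_sub_one_le_levelled_of_reg335P i U hc hMα hreg ⟨proj (T0 i) y, _, _, h⟩).trans (mul_le_mul_of_nonneg_left hslack hK0)
  rcases lt_trichotomy μ ν with hlt | heq | hgt
  · rw [hol_readY_plaqWord i U y hlt]; exact key hlt
  · subst heq; rw [hol_plaqWord_self]; simpa using hR0
  · rw [hol_readY_plaqWord_swap i U y hgt]
    have hmem : Node00.holY i U ⟨proj (T0 i) y, ν, μ, hgt⟩ ∈ G := by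
      unfold Node00.holY
      have hU := mem_of_reg335P (𝔸 := Matrix (Fin N) (Fin N) ℂ) (G := G) i hreg
      exact G.mul_mem (G.mul_mem (G.mul_mem (hU _ _) (hU _ _)) (G.inv_mem (hU _ _))) (G.inv_mem (hU _ _))
    have hU1 : Node00.holY i U ⟨proj (T0 i) y, ν, μ, hgt⟩ ∈ U1 (Matrix (Fin N) (Fin N) ℂ) :=
      ⟨hG1 _ hmem, hG1 _ (G.inv_mem hmem)⟩
    exact (B7Prop1Explicit.norm_inv_sub_one_le hU1).trans (key hgt)

omit [Nonempty (Fin N)] in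
/-- the reading of a `G`-valued configuration and its retraction are `G`-valued. [cite: Balaban1985BackgroundPropagators, (3.35) p.396 («U has values in G»), bookkeeping] -/
theorem retract_readY_mem {U : CfgY (Matrix (Fin N) (Fin N) ℂ) i} (hU : ∀ μ x, U μ x ∈ G) (c : IBondY i) (x : B7Prop1Explicit.Site (d + 1))
    (μ : Fin (d + 1)) :
    retrCfg (loK (ℓ + 1) (lvl i.hN i.D i.hk c) (zOf i c)) (bondHiK (ℓ + 1) (lvl i.hN i.D i.hk c) (zOf i c) (κOf i c)) (readY i U) x μ ∈ G :=
  retrCfg_mem (fun _ ν => hU ν _) x μ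

omit [Nonempty (Fin N)] in
/-- the retraction AGREES with the reading on the box. [cite: Balaban1985Averaging, p.24 (locality), bookkeeping] -/
theorem retract_readY_agree (U : CfgY (Matrix (Fin N) (Fin N) ℂ) i) (c : IBondY i) :
    AgreeOn (loK (ℓ + 1) (lvl i.hN i.D i.hk c) (zOf i c)) (bondHiK (ℓ + 1) (lvl i.hN i.D i.hk c) (zOf i c) (κOf i c)) (readY i U)
      (retrCfg (loK (ℓ + 1) (lvl i.hN i.D i.hk c) (zOf i c)) (bondHiK (ℓ + 1) (lvl i.hN i.D i.hk c) (zOf i c) (κOf i c)) (readY i U)) :=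
  fun _ _ hx hxe => (retrCfg_eq_of_bondIn (readY i U) ⟨hx, hxe⟩).symm

/-- ★★★ **THE RETRACTED READING SATISFIES [B7]'s GLOBAL (52) AT LEVEL `j(c)`** under print's class (3.35): `pdev Û_c ≤ K_pl·L⁴·(L^{j(c)})⁻²`.
[cite: Balaban1985Averaging, (52) p.26, Prop. 2 p.26 (locality sentence)] [cite: Balaban1985BackgroundPropagators, (3.35) p.396, (3.69) p.404] -/
theorem pdev_retract_readY_le_of_reg335P (hG1 : ∀ u : (Matrix (Fin N) (Fin N) ℂ)ˣ, u ∈ G → ‖(u : Matrix (Fin N) (Fin N) ℂ)‖ ≤ 1)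
    (U : CfgY (Matrix (Fin N) (Fin N) ℂ) i) {c₀ α₀ : ℝ} (hc : c₀ ≤ 10) (hMα : 0 ≤ (kGeo i).M * α₀)
    (hreg : (bg9KP (Matrix (Fin N) (Fin N) ℂ) G i).Reg335 c₀ α₀ U) (c : IBondY i) :
    pdev (retrCfg (loK (ℓ + 1) (lvl i.hN i.D i.hk c) (zOf i c)) (bondHiK (ℓ + 1) (lvl i.hN i.D i.hk c) (zOf i c) (κOf i c)) (readY i U)) ≤
      Kpl i ((kGeo i).M * α₀) * ((kGeo i).L ^ 4 * ((((kGeo i).L ^ lvl i.hN i.D i.hk c)⁻¹) ^ 2)) := by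
  have hL0 : (0 : ℝ) ≤ (kGeo i).L := by rw [show (kGeo i).L = ((ℓ + 1 : ℕ) : ℝ) from rfl]; positivity
  refine pdev_retrCfg_le (lo_le_hi_box i c) (readY i U) (by have := Kpl_nonneg i hMα; positivity) ?_
  intro y μ ν _ hy _ _
  exact norm_hol_readY_plaqWord_sub_one_le_of_reg335P i hG1 U hc hMα hreg c hy μ ν

end Regime

/-! ## §4 The geometry line for the socket: a fine bond under the box is within `ℓ + 4` of `c` -/

section Geometry

/-- ★ **`d_{geo9K}(c, bI f) ≤ ℓ + 4` FOR A FINE BOND `f` WHOSE SOURCE LIES IN THE DOUBLE BLOCK OF `c`** (`bI` 1-faithful: the tree's `geomT_dist_ends_le` + one triangle step,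
exactly as n06-w3's `dist_le_of_qwt_ne_zero_bI`). [cite: Balaban1984PropagatorsII, (2.45)–(2.46) p.231, (2.54) p.233] [cite: Balaban1985BackgroundPropagators, p.398 (remark after (3.47))] -/
theorem dist_bI_le_of_ends {bI : FBondY i → IBondY i}
    (hβ1 : ∀ f : FBondY i, (geomT i.D).dist (β i.hN i.D i.hk (bI f)) (blkV1 i.hN i.D f) ≤ 1) (c : IBondY i) {f : FBondY i}
    (hf : iterBlockOf (lvl i.hN i.D i.hk c) f.src = c.1.2.src ∨ iterBlockOf (lvl i.hN i.D i.hk c) f.src = c.1.2.tgt) :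
    (geo9K i).dist c (bI f) ≤ (ℓ : ℝ) + 4 := by
  change distB i (β i.hN i.D i.hk c) (β i.hN i.D i.hk (bI f)) ≤ (ℓ : ℝ) + 4
  have h3 : distB i (β i.hN i.D i.hk c) (blkV1 i.hN i.D f) ≤ (ℓ : ℝ) + 3 :=
    geomT_dist_ends_le i.hN i.D i.hk (one_le_k i) (two_le_RMh i) (one_le_Mh i) (one_le_P i) c hf
  have h1 : distB i (β i.hN i.D i.hk (bI f)) (blkV1 i.hN i.D f) ≤ 1 := hβ1 f
  have hs : distB i (blkV1 i.hN i.D f) (β i.hN i.D i.hk (bI f)) = distB i (β i.hN i.D i.hk (bI f)) (blkV1 i.hN i.D f) :=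
    dist_symm_geoBT (toKT i) _ _
  linarith [distB_triangle i (β i.hN i.D i.hk c) (blkV1 i.hN i.D f) (β i.hN i.D i.hk (bI f))]

/-- ★ … in particular when some bond of the box lies over `f` (`N_c(f) ≠ 0`, the non-vanishing entries of `B9C2LettersTorusY`).
[cite: Balaban1984PropagatorsII, (2.46) p.231] [cite: Balaban1985Averaging, (141) p.39] -/
theorem dist_bI_le_of_boxCount_ne_zero {bI : FBondY i → IBondY i}
    (hβ1 : ∀ f : FBondY i, (geomT i.D).dist (β i.hN i.D i.hk (bI f)) (blkV1 i.hN i.D f) ≤ 1) (c : IBondY i) {f : FBondY i}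
    (hf : boxCount (T0 i) (boxBonds (ℓ + 1) (lvl i.hN i.D i.hk c) (zOf i c) (κOf i c)) (f.src, f.dir) ≠ 0) :
    (geo9K i).dist c (bI f) ≤ (ℓ : ℝ) + 4 := by
  classical
  unfold boxCount at hf
  obtain ⟨s, hs⟩ := Finset.card_pos.1 (Nat.pos_of_ne_zero hf)
  rw [Finset.mem_filter] at hs
  obtain ⟨hsS, hsw⟩ := hs
  have hin : InBox (loK (ℓ + 1) (lvl i.hN i.D i.hk c) (zOf i c)) (bondHiK (ℓ + 1) (lvl i.hN i.D i.hk c) (zOf i c) (κOf i c)) s.1 :=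
    (mem_bondsIn.1 hsS).1
  have hsrc : proj (T0 i) s.1 = f.src := congrArg Prod.fst hsw
  have h := ends_of_inBox i c hin
  rw [hsrc] at h
  exact dist_bI_le_of_ends i hβ1 c h

end Geometry

end Literature.MathematicalPhysics.QuantumFieldTheory.Balaban1983to89.B9C2FormBoxRegimeY
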